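import Literature.Computability.QuantumComplexity.ZXCalculusC1Bis
import HarnessLib

/-!
# `ZX_{π/4}` modulo the calculus: supplementarity with two pairs of `-π/4` leaves (LMCS Lemma 19)

Topic `Literature/Computability/QuantumComplexity`, continuing `ZXCalculusC1Bis.lean` (layer T4 of
the formalisation of `JeandelPerdrixVilmart2018_completeness`).

* leaves of red nodes: a green state on an input of a red node is a green effect on an output
  (`Z_state_par_seq_X_merge`, `Z_states_seq_X_merge`), and the rule (K) on such a leaf
  (`dumbbell_four_par_xLeafL_neg`);
* the pieces of the printed proof of LMCS Lemma 19: the state `(Z^{(0,1)}(-π/2))^{⊗2}` fed into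
  the Hadamard-wired red nodes of Lemma (C1-bis) and the green `π/4` rotations is `e^{-iπ/4}`
  times a cup (`supp19_top`), and a cup closed by the two leafy red nodes and the green merge is
  `e^{iπ/4}/√2` times the green state (`supp19_bottom`, Hopf);
* **LMCS Lemma 19** (`supp_to_minus_pi_4`): `((S ⨾ X^{(2,1)}) ⊗ (S ⨾ X^{(2,1)}(π))) ⨾ Z^{(2,1)} =
  (X^{(0,1)}(π) ⨾ Z^{(1,0)}(-π/2)) ⊗ Z^{(0,1)}` where `S = Z^{(0,1)}(-π/4) ⊗ Z^{(0,1)}(-π/4)`.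
  Printed proof: (IV), (K), Lemma 6; Lemma (C1-bis) backwards, (IV); Lemma 15, Lemma 6; Lemma 16,
  (S2), Lemma 6; (S2), (IV), Hopf; (K), Lemma 6; Lemma 2, (IV).

## References

* E. Jeandel, S. Perdrix, R. Vilmart, LMCS 16(2):11 (2020) (arXiv:1903.06035), App. A, Lemma 19
  (`lem:supp-to-minus-pi_4`) and its proof figure `supp-to-minus-pi_4-proof` [JeandelPerdrixVilmart2018].
-/

noncomputable section

namespace Literature.Computability.QuantumComplexity

open ZXDiagram ZXClass

namespace ZXClass

/-! ### Leaves of red nodes -/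

/-- The red merge with a phase, bent on the left: `(𝕀 ⊗ X^{(1,2)}(k)) ⨾ (ε ⊗ 𝕀) = X^{(2,1)}(k)`. [cite: JeandelPerdrixVilmart2018, §2.2] -/
theorem par_xsplit_phase_seq_cap_par (k : ZMod 8) : (mk (wires 1) ⊠ mk (X 1 2 k)) ⨟ (mk cap ⊠ mk (wires 1)) = mk (X 2 1 k) := by
  rw [show mk (X 1 2 k) = mk (X 1 1 k) ⨟ mk (X 1 2 0) from by rw [X_seq_X 1 1 2 le_rfl, add_zero], wires_par_seq, seq_assoc,
    par_xsplit_seq_cap_par, par_X_seq_X 1 1 1 1 le_rfl, zero_add k]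

/-- **A green state on the first input of a red node is a green effect on its first output**:
`(Z^{(0,1)}(c) ⊗ 𝕀) ⨾ X^{(2,1)}(k) = X^{(1,2)}(k) ⨾ (Z^{(1,0)}(c) ⊗ 𝕀)`. [cite: JeandelPerdrixVilmart2018, §2.2] -/
theorem Z_state_par_seq_X_merge (c k : ZMod 8) :
    (mk (Z 0 1 c) ⊠ mk (wires 1)) ⨟ mk (X 2 1 k) = mk (xLeafL k c) := by
  simp only [xLeafL, mk_seq, mk_par]
  rw [← state_par_seq_cap c, seq_par_wires, ← seq_assoc,
    show (mk (Z 0 1 c) ⊠ mk (wires 1)) ⊠ mk (wires 1) = mk (Z 0 1 c) ⊠ mk (wires 2) from by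
      rw [← wires_par_wires 1 1]; exact (par_assoc _ _ _).trans (cast_id _ _ _),
    show mk (X 1 2 k) ⨟ (mk (Z 0 1 c) ⊠ mk (wires 2)) = mk (Z 0 1 c) ⊠ mk (X 1 2 k) from by
      rw [par_eq_seq_right (mk (Z 0 1 c)) (mk (X 1 2 k)), empty_par, cast_id],
    par_eq_seq_left (mk (Z 0 1 c)) (mk (X 1 2 k)), seq_assoc, par_xsplit_phase_seq_cap_par]

/-- Two green states on a red node: the second one becomes a leaf.
`(Z^{(0,1)}(a) ⊗ Z^{(0,1)}(c)) ⨾ X^{(2,1)}(k) = Z^{(0,1)}(a) ⨾ xLeafL k c`. [cite: JeandelPerdrixVilmart2018, §2.2] -/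
theorem Z_states_seq_X_merge (a c k : ZMod 8) :
    (mk (Z 0 1 a) ⊠ mk (Z 0 1 c)) ⨟ mk (X 2 1 k) = mk (Z 0 1 a) ⨟ mk (xLeafL k c) := by
  rw [← swap_seq_X 1 k, ← seq_assoc, Z_states_seq_swap, par_eq_seq_right (mk (Z 0 1 c)) (mk (Z 0 1 a)), empty_par_state,
    seq_assoc, Z_state_par_seq_X_merge]

/-- **(K) on a green effect**: `√2 ⊗ (X(π) ⨾ Z^{(1,0)}(α)) = (X^{(0,1)}(π) ⨾ Z^{(1,0)}(α)) ⊗ Z^{(1,0)}(-α)`.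
[cite: JeandelPerdrixVilmart2018, Fig. 1 (K)] -/
theorem sqrt_two_par_X_pi_seq_Z_effect (a : ZMod 8) :
    mk (dumbbell 0 0) ⊠ (mk (X 1 1 4) ⨟ mk (Z 1 0 a)) = mk (dumbbell 4 a) ⊠ mk (Z 1 0 (-a)) := by
  have h := congrArg transpose (sqrt_two_par_Z_state_seq_X_pi a)
  simpa [mk_transpose_dumbbell] using h

/-- A scalar in front of a `1 → 2 → 1` composite may be attached to the second factor. [folklore] -/
theorem one_two_seq_scalar_par_one (A : ZXClass 1 2) (s : ZXClass 0 0) (B : ZXClass 2 1) : A ⨟ (s ⊠ B) = s ⊠ (A ⨟ B) := by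
  rw [scalar_par_seq_right, empty_par, cast_id]

/-- **(K) on a leaf**: `(X^{(0,1)}(π) ⨾ Z^{(1,0)}(α)) ⊗ xLeafL k (-α) = √2 ⊗ xLeafL (k + π) α`.
[cite: JeandelPerdrixVilmart2018, Fig. 1 (K)] -/
theorem dumbbell_four_par_xLeafL_neg (k a : ZMod 8) :
    mk (dumbbell 4 a) ⊠ mk (xLeafL k (-a)) = mk (dumbbell 0 0) ⊠ mk (xLeafL (k + 4) a) := by
  simp only [xLeafL, mk_seq, mk_par]
  rw [show mk (X 1 2 (k + 4)) = mk (X 1 2 k) ⨟ (mk (X 1 1 4) ⊠ mk (wires 1)) from by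
      have h := congrArg colorSwap (Z_seq_Z_par 1 1 1 1 le_rfl 4 k)
      simp only [colorSwap_seq, colorSwap_par, colorSwap_mk, ZXDiagram.colorSwap_Z, ZXDiagram.colorSwap_wires] at h
      rw [h, add_comm],
    seq_assoc, ← seq_par_wires, ← one_two_seq_scalar_par_one, ← one_two_seq_scalar_par_one,
    show ∀ (s : ZXClass 0 0) (E : ZXClass 1 0), s ⊠ (E ⊠ mk (wires 1)) = (s ⊠ E) ⊠ mk (wires 1)
      from fun s E => (par_assoc' _ _ _).trans (cast_id _ _ _),
    show ∀ (s : ZXClass 0 0) (E : ZXClass 1 0), s ⊠ (E ⊠ mk (wires 1)) = (s ⊠ E) ⊠ mk (wires 1)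
      from fun s E => (par_assoc' _ _ _).trans (cast_id _ _ _),
    sqrt_two_par_X_pi_seq_Z_effect]

/-- Two scalars in front of a state on two wires regroup. [folklore] -/
theorem scalar_par_scalar_par_state_two (s t : ZXClass 0 0) (A : ZXClass 0 2) : s ⊠ (t ⊠ A) = (s ⊠ t) ⊠ A :=
  (par_assoc' _ _ _).trans (cast_id _ _ _)

/-- `√2` cancels in front of states on two wires. [cite: JeandelPerdrixVilmart2018, Appendix Lemma 5] -/
theorem cancel_sqrt_two_state_two {A B : ZXClass 0 2} (h : mk (dumbbell 0 0) ⊠ A = mk (dumbbell 0 0) ⊠ B) : A = B := by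
  have h' : mk invSqrtTwo ⊠ (mk (dumbbell 0 0) ⊠ A) = mk invSqrtTwo ⊠ (mk (dumbbell 0 0) ⊠ B) := by rw [h]
  rwa [scalar_par_scalar_par_state_two, scalar_par_scalar_par_state_two, invSqrtTwo_par_dumbbell,
    empty_par, cast_id, empty_par, cast_id] at h'

/-- A unit scalar cancels in front of states on one wire. [cite: JeandelPerdrixVilmart2018, Appendix Lemmas 5, 6] -/
theorem cancel_dumbbell_four_state (a : ZMod 8) {A B : ZXClass 0 1}
    (h : mk (dumbbell 4 a) ⊠ A = mk (dumbbell 4 a) ⊠ B) : A = B := by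
  have h' : mk (dumbbell 4 (-a)) ⊠ (mk (dumbbell 4 a) ⊠ A) = mk (dumbbell 4 (-a)) ⊠ (mk (dumbbell 4 a) ⊠ B) := by rw [h]
  rw [scalar_par_scalar_par_state, scalar_par_scalar_par_state, scalar_par_comm (mk (dumbbell 4 (-a))),
    dumbbell_four_par_dumbbell_four_neg, ← scalar_par_scalar_par_state, ← scalar_par_scalar_par_state] at h'
  exact cancel_sqrt_two_state (cancel_sqrt_two_state h')

/-! ### The bottom of LMCS Lemma 19's proof: a cup closed by two leafy red nodes and a green merge -/

/-- A state on two wires followed by a scalar-carrying effect: the scalar comes out. [folklore] -/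
theorem state_two_seq_scalar_par_zero (A : ZXClass 0 2) (s : ZXClass 0 0) (B : ZXClass 2 0) : A ⨟ (s ⊠ B) = s ⊠ (A ⨟ B) := by
  rw [scalar_par_seq_right, empty_par, cast_id]

/-- The closed red `π` node with two green `π/4` leaves is `√2 · √2 e^{iπ/4}`:
`X^{(0,2)}(π) ⨾ (Z^{(1,0)}(π/4) ⊗ Z^{(1,0)}(π/4)) = (X^{(0,1)}(π) ⨾ Z^{(1,0)}(π/4)) ⊗ √2`.
[cite: JeandelPerdrixVilmart2018, Appendix Lemma 19 (proof)] -/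
theorem X_pi_cup_seq_quarter_effects : mk (X 0 2 4) ⨟ (mk (Z 1 0 1) ⊠ mk (Z 1 0 1)) = mk (dumbbell 4 1) ⊠ mk (dumbbell 0 0) := by
  have hX : mk (X 0 2 4) = mk cup ⨟ (mk (X 1 1 4) ⊠ mk (wires 1)) := by
    have h := congrArg colorSwap (Z_seq_Z_par 0 1 1 1 le_rfl 4 0)
    simp only [colorSwap_seq, colorSwap_par, colorSwap_mk, ZXDiagram.colorSwap_Z, ZXDiagram.colorSwap_wires] at h
    rw [add_zero] at h
    rw [← h, X_zero_two]
  apply cancel_sqrt_two_left_scalar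
  rw [hX, seq_assoc, interchange, id_seq,
    show mk (dumbbell 0 0) ⊠ (mk cup ⨟ ((mk (X 1 1 4) ⨟ mk (Z 1 0 1)) ⊠ mk (Z 1 0 1))) =
        mk cup ⨟ ((mk (dumbbell 0 0) ⊠ (mk (X 1 1 4) ⨟ mk (Z 1 0 1))) ⊠ mk (Z 1 0 1)) from by
      rw [scalar_par_seq_right, empty_par, cast_id]; exact congrArg (mk cup ⨟ ·) ((par_assoc' _ _ _).trans (cast_id _ _ _)),
    sqrt_two_par_X_pi_seq_Z_effect,
    show (mk (dumbbell 4 1) ⊠ mk (Z 1 0 (-1))) ⊠ mk (Z 1 0 1) = mk (dumbbell 4 1) ⊠ (mk (Z 1 0 (-1)) ⊠ mk (Z 1 0 1))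
      from (par_assoc _ _ _).trans (cast_id _ _ _),
    state_two_seq_scalar_par_zero, par_eq_seq_left (mk (Z 1 0 (-1))) (mk (Z 1 0 1)), ← seq_assoc, cup_seq_effect_par,
    empty_par, cast_id, Z_seq_Z 0 1 0 le_rfl, neg_add_cancel, two_eq_sqrt_two_sq, scalar_par_scalar_par (mk (dumbbell 0 0)) (mk (dumbbell 4 1))]

/-- The red `4`-legged state with phase `π` as the `3`-legged one with its middle leg split. [cite: JeandelPerdrixVilmart2018, Fig. 1 (S1)] -/
theorem X_zero_four_eq : mk (X 0 4 4) = mk (X 0 3 4) ⨟ (mk (wires 1) ⊠ (mk (X 1 2 0) ⊠ mk (wires 1))) := by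
  have hX13 : mk (X 1 2 0) ⨟ (mk (X 1 2 0) ⊠ mk (wires 1)) = mk (X 1 3 0) := by
    have h := congrArg colorSwap (Z_seq_Z_par 1 1 1 2 le_rfl 0 0)
    simp only [colorSwap_seq, colorSwap_par, colorSwap_mk, ZXDiagram.colorSwap_Z, ZXDiagram.colorSwap_wires] at h
    rw [add_zero] at h
    exact h
  rw [show mk (X 0 3 4) = mk (X 0 2 4) ⨟ (mk (wires 1) ⊠ mk (X 1 2 0)) from by rw [X_seq_par_X 0 1 1 2 le_rfl, add_zero],
    seq_assoc, ← wires_par_seq, hX13, X_seq_par_X 0 1 1 3 le_rfl, add_zero]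

/-- The cup closed by the two leafy red nodes of `C(π/4, π/4)`: a red `π` state with two `π/4`
leaves whose free leg is split towards the merge. [cite: JeandelPerdrixVilmart2018, Appendix Lemma 19 (proof)] -/
theorem cup_seq_xLeaves_eq :
    mk cup ⨟ (mk (xLeafL 4 1) ⊠ mk (xLeafR 0 1)) = (mk (X 0 3 4) ⨟ ((mk (Z 1 0 1) ⊠ mk (wires 1)) ⊠ mk (Z 1 0 1))) ⨟ mk (X 1 2 0) := by
  simp only [xLeafL, xLeafR, mk_seq, mk_par]
  -- the cup fuses with the two red nodes
  have hfuse : mk cup ⨟ (mk (X 1 2 4) ⊠ mk (X 1 2 0)) = mk (X 0 4 4) := by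
    have h := congrArg colorSwap (Z_seq_Z_par 0 1 1 2 le_rfl 4 0)
    simp only [colorSwap_seq, colorSwap_par, colorSwap_mk, ZXDiagram.colorSwap_Z, ZXDiagram.colorSwap_wires] at h
    rw [add_zero] at h
    rw [← X_zero_two, par_eq_seq_left (mk (X 1 2 4)) (mk (X 1 2 0)), ← seq_assoc, h, X_seq_par_X 0 2 1 2 le_rfl, add_zero]
  rw [← interchange, ← seq_assoc, hfuse, X_zero_four_eq, seq_assoc,
    show (mk (Z 1 0 1) ⊠ mk (wires 1)) ⊠ (mk (wires 1) ⊠ mk (Z 1 0 1)) = mk (Z 1 0 1) ⊠ (mk (wires 1) ⊠ (mk (wires 1) ⊠ mk (Z 1 0 1)))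
      from (par_assoc _ _ _).trans (cast_id _ _ _), interchange, id_seq,
    show mk (wires 1) ⊠ (mk (wires 1) ⊠ mk (Z 1 0 1)) = mk (wires 2) ⊠ mk (Z 1 0 1) from by
      rw [← wires_par_wires 1 1]; exact (par_assoc' _ _ _).trans (cast_id _ _ _),
    interchange, seq_id, id_seq, seq_assoc,
    show (((mk (Z 1 0 1) ⊠ mk (wires 1)) ⊠ mk (Z 1 0 1)) ⨟ mk (X 1 2 0)) = (mk (Z 1 0 1) ⊠ mk (X 1 2 0)) ⊠ mk (Z 1 0 1) from by
      conv_lhs => rw [← par_empty (mk (X 1 2 0)), interchange, seq_id]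
      rw [par_eq_seq_left (mk (Z 1 0 1)) (mk (X 1 2 0)), empty_par, cast_id]]
  exact congrArg (mk (X 0 3 4) ⨟ ·) ((par_assoc' _ _ _).trans (cast_id _ _ _))

/-- **The bottom of Lemma 19's proof** (Hopf): `√2 ⊗ √2 ⊗ (η ⨾ (xLeafL π (π/4) ⊗ xLeafR 0 (π/4)) ⨾ Z^{(2,1)})
= ((X^{(0,1)}(π) ⨾ Z^{(1,0)}(π/4)) ⊗ √2) ⊗ Z^{(0,1)}`. [cite: JeandelPerdrixVilmart2018, Appendix Lemma 19 (proof)] -/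
theorem supp19_bottom :
    mk (dumbbell 0 0) ⊠ (mk (dumbbell 0 0) ⊠ (mk cup ⨟ (mk (xLeafL 4 1) ⊠ mk (xLeafR 0 1)) ⨟ mk (Z 2 1 0))) =
      (mk (dumbbell 4 1) ⊠ mk (dumbbell 0 0)) ⊠ mk (Z 0 1 0) := by
  -- the red effect from Hopf deletes the middle leg
  have hdel : mk (X 0 3 4) ⨟ ((mk (Z 1 0 1) ⊠ mk (wires 1)) ⊠ mk (Z 1 0 1)) ⨟ mk (X 1 0 0) = mk (X 0 2 4) ⨟ (mk (Z 1 0 1) ⊠ mk (Z 1 0 1)) := by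
    have hX11 : mk (X 1 2 0) ⨟ (mk (X 1 0 0) ⊠ mk (wires 1)) = mk (wires 1) := by
      have h := congrArg colorSwap (Z_seq_Z_par 1 1 1 0 le_rfl 0 0)
      simp only [colorSwap_seq, colorSwap_par, colorSwap_mk, ZXDiagram.colorSwap_Z, ZXDiagram.colorSwap_wires] at h
      rw [add_zero] at h
      rw [h, X_one_one]
    have e1 : (mk (Z 1 0 1) ⊠ mk (wires 1)) ⨟ mk (X 1 0 0) = mk (Z 1 0 1) ⊠ mk (X 1 0 0) := by
      rw [par_eq_seq_left (mk (Z 1 0 1)) (mk (X 1 0 0)), empty_par, cast_id]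
    have e2 : (mk (wires 1) ⊠ mk (X 1 0 0)) ⨟ mk (Z 1 0 1) = mk (Z 1 0 1) ⊠ mk (X 1 0 0) := by
      rw [par_eq_seq_right (mk (Z 1 0 1)) (mk (X 1 0 0)), par_empty]
    have hconv : ((mk (Z 1 0 1) ⊠ mk (wires 1)) ⊠ mk (Z 1 0 1)) ⨟ mk (X 1 0 0) = ((mk (wires 1) ⊠ mk (X 1 0 0)) ⊠ mk (wires 1)) ⨟ (mk (Z 1 0 1) ⊠ mk (Z 1 0 1)) := by
      conv_lhs => rw [← par_empty (mk (X 1 0 0)), interchange, seq_id, e1]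
      conv_rhs => rw [interchange, id_seq, e2]
    rw [seq_assoc, hconv, ← seq_assoc, show mk (X 0 3 4) = mk (X 0 2 4) ⨟ (mk (wires 1) ⊠ mk (X 1 2 0)) from by rw [X_seq_par_X 0 1 1 2 le_rfl, add_zero],
      seq_assoc (mk (X 0 2 4)), show (mk (wires 1) ⊠ mk (X 1 0 0)) ⊠ mk (wires 1) = mk (wires 1) ⊠ (mk (X 1 0 0) ⊠ mk (wires 1))
        from (par_assoc _ _ _).trans (cast_id _ _ _), ← wires_par_seq, hX11, wires_par_wires, seq_id]
  rw [cup_seq_xLeaves_eq, seq_assoc, ← state_seq_scalar_par, ← state_seq_scalar_par, hopf, ← seq_assoc, hdel,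
    X_pi_cup_seq_quarter_effects, scalar_par_state (mk (dumbbell 4 1) ⊠ mk (dumbbell 0 0)) (mk (Z 0 1 0)), empty_par_state]

/-! ### The top of LMCS Lemma 19's proof: the `-π/2` states fed into the Hadamard-wired red nodes -/

/-- Closed dumbbells are colour-symmetric: `X^{(0,1)}(a) ⨾ Z^{(1,0)}(b) = X^{(0,1)}(b) ⨾ Z^{(1,0)}(a)`
(the colour swap of a closed diagram is itself, rule (H) at arity `0`). [cite: JeandelPerdrixVilmart2018, Fig. 1 (H)] -/
theorem dumbbell_comm_colors (a b : ZMod 8) : mk (dumbbell a b) = mk (dumbbell b a) := by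
  have h := colorSwap_eq_conj (dumbbell a b)
  rw [mk_colorSwap_dumbbell] at h
  simpa using h.symm

/-- **(K) on a cup**: `√2 ⊗ (Z^{(0,2)}(π) ⨾ (X(π/2) ⊗ X(π/2))) = (X^{(0,1)}(π/2) ⨾ Z^{(1,0)}(π)) ⊗ Z^{(0,2)}(π)`:
the two red `π/2` slide onto one leg, where (K) lets them cancel around the green `π`.
[cite: JeandelPerdrixVilmart2018, Fig. 1 (K)] -/
theorem sqrt_two_par_Z_pi_cup_seq_xhalfpis :
    mk (dumbbell 0 0) ⊠ (mk (Z 0 2 4) ⨟ (mk (X 1 1 2) ⊠ mk (X 1 1 2))) = mk (dumbbell 2 4) ⊠ mk (Z 0 2 4) := by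
  have hW : mk (dumbbell 0 0) ⊠ (mk (X 1 1 2) ⨟ (mk (Z 1 1 4) ⨟ mk (X 1 1 2))) = mk (dumbbell 2 4) ⊠ mk (Z 1 1 4) := by
    rw [← seq_assoc, ← scalar_par_seq_one, rule_K, scalar_par_seq_one, seq_assoc, xphase_seq_xphase, neg_add_cancel, X_one_one, seq_id]
  rw [← cup_seq_phase_par, seq_assoc, interchange, id_seq, par_eq_seq_right (mk (Z 1 1 4) ⨟ mk (X 1 1 2)) (mk (X 1 1 2)),
    ← seq_assoc, cup_seq_par_xphase, seq_assoc, ← seq_par_wires, ← state_two_seq_scalar_par_two,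
    show mk (dumbbell 0 0) ⊠ ((mk (X 1 1 2) ⨟ (mk (Z 1 1 4) ⨟ mk (X 1 1 2))) ⊠ mk (wires 1)) = (mk (dumbbell 0 0) ⊠ (mk (X 1 1 2) ⨟ (mk (Z 1 1 4) ⨟ mk (X 1 1 2)))) ⊠ mk (wires 1)
      from (par_assoc' _ _ _).trans (cast_id _ _ _), hW,
    show (mk (dumbbell 2 4) ⊠ mk (Z 1 1 4)) ⊠ mk (wires 1) = mk (dumbbell 2 4) ⊠ (mk (Z 1 1 4) ⊠ mk (wires 1)) from (par_assoc _ _ _).trans (cast_id _ _ _),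
    state_two_seq_scalar_par_two]

/-- The inner diagram of the top: `db 4 1 ⊗ (Z^{(0,2)}(π/2) ⨾ ((H ⨾ Z(π/4)) ⊗ (X(π/2) ⨾ Z(π/4)))) = db 2 4 ⊗ η`
(Euler on `H`, the `π/2` fuses into the state, (K) on the cup, the phases close up to `2π`).
[cite: JeandelPerdrixVilmart2018, Appendix Lemma 19 (proof)] -/
theorem supp19_inner :
    mk (dumbbell 4 1) ⊠ (mk (Z 0 2 2) ⨟ ((mk hBox ⨟ mk (Z 1 1 1)) ⊠ (mk (X 1 1 2) ⨟ mk (Z 1 1 1)))) = mk (dumbbell 2 4) ⊠ mk cup := by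
  -- with `1/√2 ⊗ db 4 1` the Hadamard becomes `Z(π/2) X(π/2) Z(π/2)`
  have hK : (mk invSqrtTwo ⊠ mk (dumbbell 4 1)) ⊠ (mk (Z 0 2 2) ⨟ ((mk hBox ⨟ mk (Z 1 1 1)) ⊠ (mk (X 1 1 2) ⨟ mk (Z 1 1 1)))) =
      mk (Z 0 2 4) ⨟ (mk (X 1 1 2) ⊠ mk (X 1 1 2)) ⨟ (mk (Z 1 1 3) ⊠ mk (Z 1 1 1)) := by
    rw [← state_two_seq_scalar_par_two,
      show ∀ (s : ZXClass 0 0) (A N : ZXClass 1 1), s ⊠ (A ⊠ N) = (s ⊠ A) ⊠ N from fun s A N => (par_assoc' _ _ _).trans (cast_id _ _ _),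
      ← scalar_par_seq_one, show (mk invSqrtTwo ⊠ mk (dumbbell 4 1)) ⊠ mk hBox = mk invSqrtTwo ⊠ (mk (dumbbell 4 1) ⊠ mk hBox)
        from (par_assoc _ _ _).trans (cast_id _ _ _), ← euler_pos, seq_assoc, seq_assoc, phase_seq_phase,
      show (2 : ZMod 8) + 1 = 3 from by decide,
      show (mk (Z 1 1 2) ⨟ (mk (X 1 1 2) ⨟ mk (Z 1 1 3))) ⊠ (mk (X 1 1 2) ⨟ mk (Z 1 1 1)) =
          (mk (Z 1 1 2) ⊠ mk (wires 1)) ⨟ ((mk (X 1 1 2) ⊠ mk (X 1 1 2)) ⨟ (mk (Z 1 1 3) ⊠ mk (Z 1 1 1))) from by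
        rw [interchange, interchange, id_seq],
      ← seq_assoc, Z_seq_Z_par 0 1 1 1 le_rfl, show (2 : ZMod 8) + 2 = 4 from by decide, ← seq_assoc]
  -- attach `√2`, use (K) on the cup and close the phases
  have hK2 : mk (dumbbell 0 0) ⊠ ((mk invSqrtTwo ⊠ mk (dumbbell 4 1)) ⊠ (mk (Z 0 2 2) ⨟ ((mk hBox ⨟ mk (Z 1 1 1)) ⊠ (mk (X 1 1 2) ⨟ mk (Z 1 1 1))))) =
      mk (dumbbell 2 4) ⊠ mk cup := by
    rw [hK, ← scalar_par_state_two_seq_two, sqrt_two_par_Z_pi_cup_seq_xhalfpis, scalar_par_state_two_seq_two,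
      par_eq_seq_left (mk (Z 1 1 3)) (mk (Z 1 1 1)), ← seq_assoc, Z_seq_Z_par 0 1 1 1 le_rfl, Z_seq_par_Z 0 1 1 1 le_rfl,
      show (3 : ZMod 8) + 4 + 1 = 0 from by decide, Z_zero_two]
  rw [show ∀ A : ZXClass 0 2, mk (dumbbell 0 0) ⊠ ((mk invSqrtTwo ⊠ mk (dumbbell 4 1)) ⊠ A) = ((mk (dumbbell 0 0) ⊠ mk invSqrtTwo) ⊠ mk (dumbbell 4 1)) ⊠ A from
      fun A => by rw [scalar_par_scalar_par_state_two, show mk (dumbbell 0 0) ⊠ (mk invSqrtTwo ⊠ mk (dumbbell 4 1)) = (mk (dumbbell 0 0) ⊠ mk invSqrtTwo) ⊠ mk (dumbbell 4 1)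
        from (par_assoc' _ _ _).trans (cast_id _ _ _)],
    inverse_rule, empty_par, cast_id] at hK2
  exact hK2

/-- Feeding the red `π/2` states: with `u = Z^{(0,1)}(-π/2) = (1/√2 ⊗ db 4 (-1)) ⊗ X^{(0,1)}(π/2)`,
`(u ⊗ u) ⨾ R = c ⊗ c ⊗ (X^{(0,2)}(π/2) ⨾ (𝕀 ⊗ (H ⨾ X(π/2))))`, `c = 1/√2 ⊗ db 4 (-1)`. [cite: JeandelPerdrixVilmart2018, Appendix Lemmas 15, 19] -/
theorem supp19_feed :
    (mk (Z 0 1 (-2)) ⊠ mk (Z 0 1 (-2))) ⨟ ((mk (X 1 2 0) ⊠ mk (wires 1)) ⨟ (mk (wires 1) ⊠ ((mk hBox ⊠ mk (wires 1)) ⨟ mk (X 2 1 0)))) =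
      (mk invSqrtTwo ⊠ mk (dumbbell 4 (-1))) ⊠ ((mk invSqrtTwo ⊠ mk (dumbbell 4 (-1))) ⊠ (mk (X 0 2 2) ⨟ (mk (wires 1) ⊠ (mk hBox ⨟ mk (X 1 1 2))))) := by
  have hu : mk (Z 0 1 (-2)) = (mk invSqrtTwo ⊠ mk (dumbbell 4 (-1))) ⊠ mk (X 0 1 2) := by
    rw [Z_state_neg_two, Z_dot_neg_two_eq, scalar_par_scalar_par_state]
  have hM : (mk (wires 1) ⊠ mk (X 0 1 2)) ⨟ ((mk hBox ⊠ mk (wires 1)) ⨟ mk (X 2 1 0)) = mk hBox ⨟ mk (X 1 1 2) := by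
    rw [← seq_assoc, ← slide, par_empty, seq_assoc, par_X_seq_X 1 0 1 1 le_rfl, zero_add]
  rw [hu, ← seq_assoc, interchange, seq_id, scalar_par_state_one_seq_two, X_seq_X 0 1 2 le_rfl, add_zero (2 : ZMod 8),
    show ∀ (c : ZXClass 0 0) (P : ZXClass 0 2) (Q : ZXClass 0 1), (c ⊠ P) ⊠ (c ⊠ Q) = c ⊠ (c ⊠ (P ⊠ Q)) from fun c P Q => by
      rw [show (c ⊠ P) ⊠ (c ⊠ Q) = c ⊠ (P ⊠ (c ⊠ Q)) from (par_assoc _ _ _).trans (cast_id _ _ _),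
        show P ⊠ (c ⊠ Q) = (P ⊠ c) ⊠ Q from (par_assoc' _ _ _).trans (cast_id _ _ _), ← scalar_par_state_two_comm,
        show (c ⊠ P) ⊠ Q = c ⊠ (P ⊠ Q) from (par_assoc _ _ _).trans (cast_id _ _ _)],
    scalar_par_state_three_seq_two, scalar_par_state_three_seq_two, par_eq_seq_left (mk (X 0 2 2)) (mk (X 0 1 2)), par_empty,
    seq_assoc, ← wires_par_wires 1 1, show (mk (wires 1) ⊠ mk (wires 1)) ⊠ mk (X 0 1 2) = mk (wires 1) ⊠ (mk (wires 1) ⊠ mk (X 0 1 2))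
      from (par_assoc _ _ _).trans (cast_id _ _ _), ← wires_par_seq, hM]
  where
  /-- scalar in front of a state on three wires followed by a `3 → 2` map -/
  scalar_par_state_three_seq_two (s : ZXClass 0 0) (A : ZXClass 0 3) (B : ZXClass 3 2) : (s ⊠ A) ⨟ B = s ⊠ (A ⨟ B) := by
    rw [scalar_par_seq_left, empty_par, cast_id]

/-- **The top of Lemma 19's proof**: `db 4 1 ⊗ ((u ⊗ u) ⨾ R ⨾ (Z(π/4) ⊗ Z(π/4))) = √2 ⊗ η` for
`u = Z^{(0,1)}(-π/2)` and `R` the Hadamard-wired red nodes of Lemma (C1-bis). [cite: JeandelPerdrixVilmart2018, Appendix Lemma 19 (proof)] -/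
theorem supp19_top :
    mk (dumbbell 4 1) ⊠ ((mk (Z 0 1 (-2)) ⊠ mk (Z 0 1 (-2))) ⨟ ((mk (X 1 2 0) ⊠ mk (wires 1)) ⨟ (mk (wires 1) ⊠ ((mk hBox ⊠ mk (wires 1)) ⨟ mk (X 2 1 0)))) ⨟
      (mk (Z 1 1 1) ⊠ mk (Z 1 1 1))) = mk (dumbbell 0 0) ⊠ mk cup := by
  -- the inner diagram, colour-changed
  have hinner : (mk (X 0 2 2) ⨟ (mk (wires 1) ⊠ (mk hBox ⨟ mk (X 1 1 2)))) ⨟ (mk (Z 1 1 1) ⊠ mk (Z 1 1 1)) =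
      mk (Z 0 2 2) ⨟ ((mk hBox ⨟ mk (Z 1 1 1)) ⊠ (mk (X 1 1 2) ⨟ mk (Z 1 1 1))) := by
    rw [X_eq_conj 0 2 2, hTensor_zero, id_seq, hTensor_two, seq_assoc, seq_assoc, ← seq_assoc (mk hBox ⊠ mk hBox),
      interchange, seq_id, ← seq_assoc (mk hBox) (mk hBox), hBox_seq_hBox, id_seq, interchange]
  rw [supp19_feed, scalar_par_state_two_seq_two, scalar_par_state_two_seq_two, hinner,
    scalar_par_scalar_par (mk (dumbbell 4 1)),
    scalar_par_scalar_par (mk (dumbbell 4 1)) (mk invSqrtTwo ⊠ mk (dumbbell 4 (-1))), supp19_inner, dumbbell_comm_colors 2 4,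
    scalar_par_scalar_par_state_two, scalar_par_scalar_par_state_two,
    show ((mk invSqrtTwo ⊠ mk (dumbbell 4 (-1))) ⊠ (mk invSqrtTwo ⊠ mk (dumbbell 4 (-1)))) ⊠ mk (dumbbell 4 2) = mk (dumbbell 0 0) from by
      rw [show ((mk invSqrtTwo ⊠ mk (dumbbell 4 (-1))) ⊠ (mk invSqrtTwo ⊠ mk (dumbbell 4 (-1)))) ⊠ mk (dumbbell 4 2) =
          (mk invSqrtTwo ⊠ mk (dumbbell 4 (-1))) ⊠ ((mk invSqrtTwo ⊠ mk (dumbbell 4 (-1))) ⊠ mk (dumbbell 4 2)) from (par_assoc _ _ _).trans (cast_id _ _ _),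
        show (mk invSqrtTwo ⊠ mk (dumbbell 4 (-1))) ⊠ mk (dumbbell 4 2) = mk invSqrtTwo ⊠ (mk (dumbbell 4 (-1)) ⊠ mk (dumbbell 4 2))
          from (par_assoc _ _ _).trans (cast_id _ _ _), dumbbell_four_mul, show (-1 : ZMod 8) + 2 = 1 from by decide,
        show (mk invSqrtTwo ⊠ mk (dumbbell 4 (-1))) ⊠ (mk invSqrtTwo ⊠ (mk (dumbbell 4 1) ⊠ mk (dumbbell 0 0))) =
          mk invSqrtTwo ⊠ (mk (dumbbell 4 (-1)) ⊠ (mk invSqrtTwo ⊠ (mk (dumbbell 4 1) ⊠ mk (dumbbell 0 0)))) from (par_assoc _ _ _).trans (cast_id _ _ _),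
        scalar_par_scalar_par (mk (dumbbell 4 (-1))) (mk invSqrtTwo),
        show mk (dumbbell 4 (-1)) ⊠ (mk (dumbbell 4 1) ⊠ mk (dumbbell 0 0)) = (mk (dumbbell 4 (-1)) ⊠ mk (dumbbell 4 1)) ⊠ mk (dumbbell 0 0)
          from (par_assoc' _ _ _).trans (cast_id _ _ _), dumbbell_four_mul, neg_add_cancel, dumbbell_four_zero,
        show ∀ s : ZXClass 0 0, mk invSqrtTwo ⊠ ((mk (dumbbell 0 0) ⊠ mk (dumbbell 0 0)) ⊠ s) = ((mk invSqrtTwo ⊠ mk (dumbbell 0 0)) ⊠ mk (dumbbell 0 0)) ⊠ s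
          from fun s => by
            rw [show mk invSqrtTwo ⊠ ((mk (dumbbell 0 0) ⊠ mk (dumbbell 0 0)) ⊠ s) = (mk invSqrtTwo ⊠ (mk (dumbbell 0 0) ⊠ mk (dumbbell 0 0))) ⊠ s
              from (par_assoc' _ _ _).trans (cast_id _ _ _),
              show mk invSqrtTwo ⊠ (mk (dumbbell 0 0) ⊠ mk (dumbbell 0 0)) = (mk invSqrtTwo ⊠ mk (dumbbell 0 0)) ⊠ mk (dumbbell 0 0)
              from (par_assoc' _ _ _).trans (cast_id _ _ _)],
        invSqrtTwo_par_dumbbell, empty_par, cast_id,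
        show mk invSqrtTwo ⊠ (mk (dumbbell 0 0) ⊠ mk (dumbbell 0 0)) = (mk invSqrtTwo ⊠ mk (dumbbell 0 0)) ⊠ mk (dumbbell 0 0)
          from (par_assoc' _ _ _).trans (cast_id _ _ _), invSqrtTwo_par_dumbbell, empty_par, cast_id]]

/-! ### LMCS Lemma 19 -/

/-- A state on two wires followed by a scalar-carrying `2 → 1` map: the scalar comes out. [folklore] -/
theorem state_two_seq_scalar_par_one (A : ZXClass 0 2) (s : ZXClass 0 0) (B : ZXClass 2 1) : A ⨟ (s ⊠ B) = s ⊠ (A ⨟ B) := by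
  rw [scalar_par_seq_right, empty_par, cast_id]

/-- Two scalars in front of two parallel `1 → 1` maps distribute. [folklore] -/
theorem scalar_sq_par_par_one_one (s : ZXClass 0 0) (A B : ZXClass 1 1) : s ⊠ (s ⊠ (A ⊠ B)) = (s ⊠ A) ⊠ (s ⊠ B) := by
  rw [show s ⊠ (A ⊠ B) = (s ⊠ A) ⊠ B from (par_assoc' _ _ _).trans (cast_id _ _ _),
    show s ⊠ ((s ⊠ A) ⊠ B) = (s ⊠ (s ⊠ A)) ⊠ B from (par_assoc' _ _ _).trans (cast_id _ _ _),
    scalar_par_one_comm s (s ⊠ A), show ((s ⊠ A) ⊠ s) ⊠ B = (s ⊠ A) ⊠ (s ⊠ B) from (par_assoc _ _ _).trans (cast_id _ _ _)]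

/-- **LMCS Lemma 19** (supplementarity with two pairs of `-π/4` leaves): with
`S = Z^{(0,1)}(-π/4) ⊗ Z^{(0,1)}(-π/4)`,
`((S ⨾ X^{(2,1)}) ⊗ (S ⨾ X^{(2,1)}(π))) ⨾ Z^{(2,1)} = (X^{(0,1)}(π) ⨾ Z^{(1,0)}(-π/2)) ⊗ Z^{(0,1)}`.
[cite: JeandelPerdrixVilmart2018, Appendix Lemma 19] -/
theorem supp_to_minus_pi_4 :
    (((mk (Z 0 1 (-1)) ⊠ mk (Z 0 1 (-1))) ⨟ mk (X 2 1 0)) ⊠ ((mk (Z 0 1 (-1)) ⊠ mk (Z 0 1 (-1))) ⨟ mk (X 2 1 4))) ⨟ mk (Z 2 1 0) =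
      mk (dumbbell 4 (-2)) ⊠ mk (Z 0 1 0) := by
  -- (a) the second states become leaves; (b) (K) on the leaves, with `db 4 1 ⊗ db 4 1`
  have h2 : mk (dumbbell 4 1) ⊠ (mk (dumbbell 4 1) ⊠ (mk (xLeafL 0 (-1)) ⊠ mk (xLeafL 4 (-1)))) =
      mk (dumbbell 0 0) ⊠ (mk (dumbbell 0 0) ⊠ (mk (xLeafL 4 1) ⊠ mk (xLeafR 0 1))) := by
    rw [scalar_sq_par_par_one_one, scalar_sq_par_par_one_one, dumbbell_four_par_xLeafL_neg, dumbbell_four_par_xLeafL_neg,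
      zero_add (4 : ZMod 8), show (4 : ZMod 8) + 4 = 0 from by decide, xLeafL_eq_xLeafR 0 1]
  have h3 : mk (Z 0 1 (-1)) ⊠ mk (Z 0 1 (-1)) = (mk (Z 0 1 (-2)) ⊠ mk (Z 0 1 (-2))) ⨟ (mk (Z 1 1 1) ⊠ mk (Z 1 1 1)) := by
    rw [interchange, Z_seq_Z 0 1 1 le_rfl, show (-2 : ZMod 8) + 1 = -1 from by decide]
  -- (c) Lemma (C1-bis) backwards inserts the Hadamard-wired red nodes
  have h4 : ((mk (Z 0 1 (-2)) ⊠ mk (Z 0 1 (-2))) ⨟ (mk (Z 1 1 1) ⊠ mk (Z 1 1 1))) ⨟ (mk (xLeafL 4 1) ⊠ mk (xLeafR 0 1)) ⨟ mk (Z 2 1 0) =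
      mk (dumbbell 0 0) ⊠ (((((mk (Z 0 1 (-2)) ⊠ mk (Z 0 1 (-2))) ⨟ ((mk (X 1 2 0) ⊠ mk (wires 1)) ⨟ (mk (wires 1) ⊠ ((mk hBox ⊠ mk (wires 1)) ⨟ mk (X 2 1 0))))) ⨟
        (mk (Z 1 1 1) ⊠ mk (Z 1 1 1))) ⨟ (mk (xLeafL 4 1) ⊠ mk (xLeafR 0 1))) ⨟ mk (Z 2 1 0)) := by
    rw [seq_assoc (mk (Z 0 1 (-2)) ⊠ mk (Z 0 1 (-2))), seq_assoc (mk (Z 0 1 (-2)) ⊠ mk (Z 0 1 (-2))), ← c1bis 1 1,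
      state_two_seq_scalar_par_one, ← seq_assoc (mk (Z 0 1 (-2)) ⊠ mk (Z 0 1 (-2))),
      ← seq_assoc ((mk (Z 0 1 (-2)) ⊠ mk (Z 0 1 (-2))) ⨟ ((mk (X 1 2 0) ⊠ mk (wires 1)) ⨟ (mk (wires 1) ⊠ ((mk hBox ⊠ mk (wires 1)) ⨟ mk (X 2 1 0)))))
        (mk (Z 1 1 1) ⊠ mk (Z 1 1 1) ⨟ (mk (xLeafL 4 1) ⊠ mk (xLeafR 0 1))) (mk (Z 2 1 0)),
      ← seq_assoc ((mk (Z 0 1 (-2)) ⊠ mk (Z 0 1 (-2))) ⨟ ((mk (X 1 2 0) ⊠ mk (wires 1)) ⨟ (mk (wires 1) ⊠ ((mk hBox ⊠ mk (wires 1)) ⨟ mk (X 2 1 0)))))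
        (mk (Z 1 1 1) ⊠ mk (Z 1 1 1)) (mk (xLeafL 4 1) ⊠ mk (xLeafR 0 1))]
  -- (d) the top is `√2/db 4 1` times a cup; (e) the bottom by Hopf
  have h5 : mk (dumbbell 4 1) ⊠ (((((mk (Z 0 1 (-2)) ⊠ mk (Z 0 1 (-2))) ⨟ ((mk (X 1 2 0) ⊠ mk (wires 1)) ⨟ (mk (wires 1) ⊠ ((mk hBox ⊠ mk (wires 1)) ⨟ mk (X 2 1 0))))) ⨟
        (mk (Z 1 1 1) ⊠ mk (Z 1 1 1))) ⨟ (mk (xLeafL 4 1) ⊠ mk (xLeafR 0 1))) ⨟ mk (Z 2 1 0)) =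
      mk (dumbbell 0 0) ⊠ ((mk cup ⨟ (mk (xLeafL 4 1) ⊠ mk (xLeafR 0 1))) ⨟ mk (Z 2 1 0)) := by
    rw [← scalar_par_state_two_seq_one, ← scalar_par_state_two_seq_two, supp19_top, scalar_par_state_two_seq_two, scalar_par_state_two_seq_one]
  -- the assembly: three `db 4 1` on both sides
  refine cancel_dumbbell_four_state 1 (cancel_dumbbell_four_state 1 (cancel_dumbbell_four_state 1 ?_))
  rw [Z_states_seq_X_merge, Z_states_seq_X_merge, ← interchange]
  conv_lhs => rw [← scalar_par_state_two_seq_one, ← scalar_par_state_two_seq_one, ← scalar_par_state_two_seq_one,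
    ← state_two_seq_scalar_par_two, ← state_two_seq_scalar_par_two,
    h2, state_two_seq_scalar_par_two, state_two_seq_scalar_par_two,
    scalar_par_state_two_seq_one, scalar_par_state_two_seq_one, scalar_par_state_two_seq_one,
    h3, h4, scalar_par_scalar_par (mk (dumbbell 4 1)) (mk (dumbbell 0 0)), scalar_par_scalar_par (mk (dumbbell 4 1)) (mk (dumbbell 0 0)),
    scalar_par_scalar_par (mk (dumbbell 4 1)) (mk (dumbbell 0 0)), h5, supp19_bottom]
  -- both sides are now scalars in front of `Z^{(0,1)}`
  rw [show ((mk (dumbbell 4 1) ⊠ mk (dumbbell 0 0)) ⊠ mk (Z 0 1 0)) = mk (dumbbell 4 1) ⊠ (mk (dumbbell 0 0) ⊠ mk (Z 0 1 0)) from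
      (par_assoc _ _ _).trans (cast_id _ _ _),
    scalar_par_scalar_par (mk (dumbbell 0 0)) (mk (dumbbell 4 1)), scalar_par_scalar_par (mk (dumbbell 0 0)) (mk (dumbbell 4 1)),
    scalar_par_scalar_par_state (mk (dumbbell 4 1)) (mk (dumbbell 4 (-2))) (mk (Z 0 1 0)), dumbbell_four_mul,
    show (1 : ZMod 8) + -2 = -1 from by decide,
    show (mk (dumbbell 4 (-1)) ⊠ mk (dumbbell 0 0)) ⊠ mk (Z 0 1 0) = mk (dumbbell 4 (-1)) ⊠ (mk (dumbbell 0 0) ⊠ mk (Z 0 1 0)) from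
      (par_assoc _ _ _).trans (cast_id _ _ _),
    scalar_par_scalar_par_state (mk (dumbbell 4 1)) (mk (dumbbell 4 (-1))) (mk (dumbbell 0 0) ⊠ mk (Z 0 1 0)), dumbbell_four_mul,
    add_neg_cancel, dumbbell_four_zero,
    show (mk (dumbbell 0 0) ⊠ mk (dumbbell 0 0)) ⊠ (mk (dumbbell 0 0) ⊠ mk (Z 0 1 0)) = mk (dumbbell 0 0) ⊠ (mk (dumbbell 0 0) ⊠ (mk (dumbbell 0 0) ⊠ mk (Z 0 1 0)))
      from (par_assoc _ _ _).trans (cast_id _ _ _)]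

end ZXClass

end Literature.Computability.QuantumComplexity
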